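import Summits.BirchSwinnertonDyer.Rank1Residual.X2.TwistTamagawa
import Summits.BirchSwinnertonDyer.Rank1Residual.X11b.Three.RouteR1Tamagawa
import HarnessLib

/-!
# `ord_p ∏_w c_w(E/K) = 2 · ord_p ∏_ℓ c_ℓ(E)` on a HEEGNER field at EVERY ODD prime `p`
# (cell `bsd-eis`, seat `bsd-eis-cgshw` g4; the binder `htamK` of the non-split O9 road (b1))

HONEST FRAMING (cell `bsd-eis`): theorems only; nothing booked; X2 stays CONSTRUCTION-SHAPED; no
label moves. The (b1) road `X2/NonsplitHalvesOnTree.lean` (p404431 / p404695) carries the binder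
`htamK : ord_p ∏_w c_w(E/K) = 2 · ord_p ∏_ℓ c_ℓ(E)` for the CGLS / Heegner field `K` of a rank-one X2
pair (Jetchev–Skinner–Wan 2017 (eq:tamK) "`∏_w c_w(E/K) = ∏_ℓ c_ℓ(E/ℚ)²`", CGLS 2022 (5.6)). In the
tree it is multr1-p1's `X11b.padicValNat_tamagawaProduct_baseChange_quadratic_eq_two_mul` with
`5 ≤ p` WIRED IN (the uniform bound `c ≤ 4 < p` at non-split places), useless on 12 106 of the
12 665 O9 cells (`p = 3`). Here it is proved at every ODD `p` for `K` imaginary quadratic with `d_K`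
odd satisfying the classical Heegner hypothesis for `N_E` and `p` split in `K`, by reduction type:
every bad prime splits, so a non-split place `v ↔ ℓ` is GOOD for `E` and for `E_K` (`c = 1`), and
the twist `E^{(d_K)}` there is good (`ℓ ∤ d_K`; `d_K ≡ 1 (mod 4)`, unramified twist) or of Kodaira
type `I₀*` with `c ∈ {1, 2, 4}` (`ℓ ∣ d_K`, `ℓ` odd, `ℓ ∥ d_K`) — never IV/IV*. Assembly over the
fibres of `w ↦ w ∩ ℤ` by x11b3's `X11b.Three.padicValNat_tamagawaProduct_baseChange_of_fibrewise`;
the twist half `ord_p ∏c(E^{(d_K)}) = ord_p ∏c(E)` is `X2.padicValNat_tamagawaProduct_twist_of_heegner_of_odd`.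

* `padicValNat_sum_fibre_eq_of_heegner_odd` — the per-place identity;
* `padicValNat_tamagawaProduct_baseChange_of_heegner_odd` — the product identity (discharges `htamK`).

References: [JetchevSkinnerWan2017] §7.4.1 (eq:tamK); [CastellaEtAl2021] (5.6); [Castella2018] §5
(Tamagawa relation); [SilvermanATAEC1994] IV.9.4 and Table 4.1; [SilvermanAEC2009] VII.2.
-/

set_option autoImplicit false

noncomputable section

open scoped Classical

open WeierstrassCurve NumberField IsDedekindDomain Literature.NumberTheory.EllipticCurves
  Literature.NumberTheory.QuadraticFields Literature.NumberTheory.EllipticCurves.Rank1Residual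
  Summit.BirchSwinnertonDyer.Rank1Residual.X11b

namespace Summit.BirchSwinnertonDyer.Rank1Residual.X2

/-! ### `ord_p ∏_w c_w(E/K) = 2·ord_p ∏_ℓ c_ℓ(E)` on a Heegner field, every odd `p` -/

section Tamagawa

/-- **The Tamagawa relation one rational place at a time, at an ODD prime `p`, on a HEEGNER field.**
For `W/ℚ` globally minimal elliptic of conductor `N`, `K` imaginary quadratic with `d_K` odd in which
every prime of `N` splits, `Wd = C • W^{(d_K)}` an elliptic model of the twist, and a finite place
`v ↔ ℓ` of `ℚ`: `Σ_{w ∣ v} ord_p c_w(E_K) = ord_p c_v(E) + ord_p c_v(E^{(d_K)})`. Split `v`: both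
places above have `c_w = c_v(E)` (degree one) and `c_v(E^{(d)}) = c_v(E)` (`d_K ∈ (ℚ_ℓ^×)²`).
Non-split `v`: `ℓ ∤ N` (Heegner hypothesis), so `E` is good at `v` and `E_K` at the place above
(`c = 1`); the twist is good when `ℓ ∤ d_K` (`d_K ≡ 1 (mod 4)`: unramified twist,
`hasGoodReductionAt_twist_of_not_dvd`) and of Kodaira type `I₀*` with `c ∈ {1, 2, 4}` when `ℓ ∣ d_K`
(`ℓ` odd, `ℓ ∥ d_K`: `Additive.tamagawaNumberAt_twist_of_semistable_mem`) — a `p`-unit for odd `p`.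
The erratum-field version (one non-split multiplicative prime allowed) is x11b3's
`X11b.Three.padicValNat_sum_fibre_eq_of_isErratumField`; the `5 ≤ p` version is multr1-p1's
`X11b.padicValNat_sum_fibre_eq`. [cite: JetchevSkinnerWan2017, §7.4.1 (eq:tamK) (pp. 29–31)]
[cite: SilvermanATAEC1994, IV.9.4 Steps 6–7 and Table 4.1] -/
theorem padicValNat_sum_fibre_eq_of_heegner_odd (W : WeierstrassCurve ℚ) [W.IsElliptic]
    [W.IsGloballyMinimal] (p : ℕ) [Fact p.Prime] (hp2 : p ≠ 2) (K : Type) [Field K] [NumberField K]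
    [(W.baseChange K).IsElliptic] (hK : IsImaginaryQuadratic K) (hodd : Odd (NumberField.discr K))
    (hH : SatisfiesHeegnerHypothesis (W.conductorNorm ℤ) K)
    (Wd : WeierstrassCurve ℚ) [Wd.IsElliptic] {C : VariableChange ℚ}
    (hC : C • W.quadraticTwist (NumberField.discr K : ℚ) = Wd) (v : HeightOneSpectrum (𝓞 ℚ)) :
    (∑ w ∈ (HeightOneSpectrum.finite_setOf_under_eq_of_numberField (K := K) v).toFinset,
        padicValNat p (((W.baseChange K).baseChange (w.adicCompletion K)).localTamagawaNumber
          (w.adicCompletionIntegers K))) =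
      padicValNat p ((W.baseChange (v.adicCompletion ℚ)).localTamagawaNumber
          (v.adicCompletionIntegers ℚ)) +
        padicValNat p ((Wd.baseChange (v.adicCompletion ℚ)).localTamagawaNumber
          (v.adicCompletionIntegers ℚ)) := by
  have hpr : p.Prime := Fact.out
  have h2 : Module.finrank ℚ K = 2 := hK.1
  set ℓ : ℕ := (Rat.HeightOneSpectrum.primesEquiv v : ℕ) with hℓdef
  haveI hℓ : Fact ℓ.Prime := ⟨(Rat.HeightOneSpectrum.primesEquiv v).2⟩
  have hvℓ : (Rat.HeightOneSpectrum.primesEquiv v : ℕ) = ℓ := rfl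
  have hd : (NumberField.discr K : ℚ) ≠ 0 := by exact_mod_cast NumberField.discr_ne_zero K
  have hdZ : (NumberField.discr K : ℤ) ≠ 0 := NumberField.discr_ne_zero K
  have hfin := HeightOneSpectrum.finite_setOf_under_eq_of_numberField (K := K) v
  have hodd2 : ¬ (2 : ℤ) ∣ NumberField.discr K := by
    obtain ⟨m, hm⟩ := hodd
    omega
  -- `d_K ≡ 1 (mod 4)` for an odd fundamental discriminant
  have hDk : NumberField.discr K = 4 * (NumberField.discr K / 4) + 1 := by
    rcases Quadratic.isFundamentalDiscriminant_discr (K := K) hK.1 with ⟨h1, -, -⟩ | ⟨h4, -, -⟩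
    · omega
    · exfalso
      obtain ⟨k, hk⟩ := h4
      obtain ⟨m, hm⟩ := hodd
      omega
  -- the case of a single place `w` above `v` (inert or ramified): `ℓ ∤ N`, all three are `p`-units
  have key : ∀ (w : HeightOneSpectrum (𝓞 K)),
      {w' : HeightOneSpectrum (𝓞 K) | w'.under (𝓞 ℚ) = v} = {w} →
      (∑ w ∈ hfin.toFinset,
          padicValNat p (((W.baseChange K).baseChange (w.adicCompletion K)).localTamagawaNumber
            (w.adicCompletionIntegers K)) =
        padicValNat p ((W.baseChange (v.adicCompletion ℚ)).localTamagawaNumber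
            (v.adicCompletionIntegers ℚ)) +
          padicValNat p ((Wd.baseChange (v.adicCompletion ℚ)).localTamagawaNumber
            (v.adicCompletionIntegers ℚ))) := by
    intro w hset
    have hw : w.under (𝓞 ℚ) = v := by
      have h : w ∈ ({w} : Set (HeightOneSpectrum (𝓞 K))) := Set.mem_singleton _
      rwa [← hset] at h
    haveI : w.asIdeal.LiesOver v.asIdeal := ⟨by rw [← hw]; rfl⟩
    have hF : hfin.toFinset = {w} := by
      ext w'
      rw [Set.Finite.mem_toFinset, hset]
      simp
    -- `ℓ` does not split in `K`, hence (Heegner hypothesis) `ℓ ∤ N`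
    have hns : ¬ SplitsIn K ℓ := by
      show ((Ideal.span {(ℓ : ℤ)}).primesOver (𝓞 K)).ncard ≠ 2
      rw [hℓdef, ncard_primesOver_span_eq K v, hset, Set.ncard_singleton]
      decide
    have hℓN : ¬ ℓ ∣ W.conductorNorm ℤ := fun hℓN => hns (hH ℓ hℓ.out hℓN)
    have hgood : W.HasGoodReductionAt v :=
      (hasGoodReductionAtPrime_primesEquiv_iff_holds W v ℓ hvℓ).mp
        (by
          by_contra hbad'
          exact hℓN ((W.dvd_conductorNorm_iff_not_hasGoodReductionAtPrime ℓ).mpr hbad'))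
    -- `c_v(E) = 1`, `c_w(E_K) = 1`
    have hQ : padicValNat p ((W.baseChange (v.adicCompletion ℚ)).localTamagawaNumber
        (v.adicCompletionIntegers ℚ)) = 0 := by
      rw [localTamagawaNumber_eq_one_of_good' v W
        (WeierstrassCurve.localTamagawaNumber_eq_one_of_hasGoodReduction_holds _ _) hgood]
      simp
    have hgoodK : (W.baseChange K).HasGoodReductionAt w :=
      hasGoodReductionAt_baseChange_of_hasGoodReductionAt_rat W v w hgood
    have hKw : padicValNat p (((W.baseChange K).baseChange (w.adicCompletion K)).localTamagawaNumber
        (w.adicCompletionIntegers K)) = 0 := by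
      rw [localTamagawaNumber_eq_one_of_good' w (W.baseChange K)
        (WeierstrassCurve.localTamagawaNumber_eq_one_of_hasGoodReduction_holds _ _) hgoodK]
      simp
    -- the twist at `v`
    have hD : padicValNat p ((Wd.baseChange (v.adicCompletion ℚ)).localTamagawaNumber
        (v.adicCompletionIntegers ℚ)) = 0 := by
      by_cases hℓd : ((Rat.HeightOneSpectrum.primesEquiv v : ℕ) : ℤ) ∣ NumberField.discr K
      · -- ramified `ℓ ∣ d_K`: `ℓ` odd, `ℓ ∥ d_K`, twist of Kodaira type `I₀*`, `c ∈ {1, 2, 4}`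
        have hℓ2 : (Rat.HeightOneSpectrum.primesEquiv v : ℕ) ≠ 2 := by
          intro h
          apply hodd2
          have h' : (((Rat.HeightOneSpectrum.primesEquiv v : ℕ) : ℤ)) = 2 := by rw [h]; rfl
          rwa [h'] at hℓd
        have hsq : ¬ ((Rat.HeightOneSpectrum.primesEquiv v : ℕ) : ℤ) ^ 2 ∣ NumberField.discr K :=
          Literature.NumberTheory.QuadraticFields.Quadratic.not_sq_dvd_discr_of_prime_ne_two h2
            hℓ.out hℓ2
        have hmem := Additive.tamagawaNumberAt_twist_of_semistable_mem v W hℓ2 hdZ hℓd hsq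
          (Or.inl hgood) C hC
        rw [tamagawaNumberAt_def] at hmem
        have h4 : ¬ p ∣ 4 := fun h => hp2 ((Nat.prime_dvd_prime_iff_eq hpr Nat.prime_two).mp
          (hpr.dvd_of_dvd_pow (show p ∣ 2 ^ 2 by simpa using h)))
        have h2' : ¬ p ∣ 2 := fun h => hp2 ((Nat.prime_dvd_prime_iff_eq hpr Nat.prime_two).mp h)
        rcases hmem with h | h | h <;> rw [h]
        · simp
        · exact padicValNat.eq_zero_of_not_dvd h2'
        · exact padicValNat.eq_zero_of_not_dvd h4
      · -- unramified `ℓ ∤ d_K`: the twist is good at `v` as well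
        have hgoodd : Wd.HasGoodReductionAt v :=
          X2.hasGoodReductionAt_twist_of_not_dvd W v hDk hℓd hgood C hC
        rw [localTamagawaNumber_eq_one_of_good' v Wd
          (WeierstrassCurve.localTamagawaNumber_eq_one_of_hasGoodReduction_holds _ _) hgoodd]
        simp
    rw [hF, Finset.sum_singleton, hKw, hQ, hD]
  rcases placesOver_trichotomy_of_finrank_eq_two K h2 v with
    ⟨w₁, w₂, hne, hset, hef⟩ | ⟨w, hset, -, -⟩ | ⟨w, hset, -, -⟩
  · -- split: two places of degree one, and `d_K` is a square in `ℚ_ℓ`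
    have hw₁ : w₁.under (𝓞 ℚ) = v := by
      have h : w₁ ∈ ({w₁, w₂} : Set (HeightOneSpectrum (𝓞 K))) := Set.mem_insert _ _
      rwa [← hset] at h
    have hw₂ : w₂.under (𝓞 ℚ) = v := by
      have h : w₂ ∈ ({w₁, w₂} : Set (HeightOneSpectrum (𝓞 K))) :=
        Set.mem_insert_of_mem _ (Set.mem_singleton _)
      rwa [← hset] at h
    obtain ⟨he₁, hf₁⟩ := hef w₁ hw₁
    obtain ⟨he₂, hf₂⟩ := hef w₂ hw₂
    have hF : hfin.toFinset = {w₁, w₂} := by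
      ext w
      rw [Set.Finite.mem_toFinset, hset]
      simp
    have hs : SplitsIn K ℓ := by
      show ((Ideal.span {(ℓ : ℤ)}).primesOver (𝓞 K)).ncard = 2
      rw [hℓdef, ncard_primesOver_span_eq K v, hset, Set.ncard_pair hne]
    have hsq := isSquare_padic_discr_of_splitsIn h2 hs
    have c₁ := localTamagawaNumber_baseChange_eq_of_degree_one W w₁ he₁ hf₁
    have c₂ := localTamagawaNumber_baseChange_eq_of_degree_one W w₂ he₂ hf₂
    rw [hw₁] at c₁
    rw [hw₂] at c₂
    rw [hF, Finset.sum_pair hne, c₁, c₂,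
      localTamagawaNumber_eq_of_twist_of_isSquare W v hvℓ hd hsq Wd hC]
  · exact key w hset
  · exact key w hset

/-- **`ord_p ∏_w c_w(E/K) = 2 · ord_p ∏_ℓ c_ℓ(E)` at every ODD prime `p` split in a HEEGNER field**
(`K` imaginary quadratic, `d_K` odd, every prime of `N_E` split in `K`, `p` split in `K`) —
Jetchev–Skinner–Wan 2017 (eq:tamK) "`∏_w c_w(E/K) = ∏_ℓ c_ℓ(E/ℚ)²`" / CGLS 2022 (5.6) read
`p`-adically, INCLUDING `p = 3`: the per-place identity `padicValNat_sum_fibre_eq_of_heegner_odd`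
assembled by `X11b.Three.padicValNat_tamagawaProduct_baseChange_of_fibrewise`, and the twist half
`ord_p ∏c(E^{(d_K)}) = ord_p ∏c(E)` (`padicValNat_tamagawaProduct_twist_of_heegner_of_odd`, needs
`p ∤ d_K`, i.e. `p` unramified — here split). Discharges the binder `htamK` of the (b1) road.
[cite: JetchevSkinnerWan2017, §7.4.1 (eq:tamK) (pp. 29–31)] [cite: CastellaEtAl2021, (5.6)] -/
theorem padicValNat_tamagawaProduct_baseChange_of_heegner_odd (W : WeierstrassCurve ℚ)
    [W.IsElliptic] [W.IsGloballyMinimal] (p : ℕ) [Fact p.Prime] (hp2 : p ≠ 2) (K : Type) [Field K]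
    [NumberField K] (hK : IsImaginaryQuadratic K) (hodd : Odd (NumberField.discr K))
    (hH : SatisfiesHeegnerHypothesis (W.conductorNorm ℤ) K) (hsplit : SatisfiesHeegnerHypothesis p K) :
    padicValNat p (W.baseChange K).tamagawaProduct = 2 * padicValNat p W.tamagawaProduct := by
  have hp : p.Prime := Fact.out
  have hd : (NumberField.discr K : ℚ) ≠ 0 := by exact_mod_cast NumberField.discr_ne_zero K
  haveI := W.isElliptic_quadraticTwist hd
  haveI hEK : (W.baseChange K).IsElliptic := by rw [baseChange]; infer_instance
  have hpd : ¬ (p : ℤ) ∣ NumberField.discr K := not_dvd_discr_of_split hK hp hp2 hsplit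
  rw [X11b.Three.padicValNat_tamagawaProduct_baseChange_of_fibrewise W p K
      (W.quadraticTwist (NumberField.discr K : ℚ))
      (fun v => padicValNat_sum_fibre_eq_of_heegner_odd W p hp2 K hK hodd hH
        (W.quadraticTwist (NumberField.discr K : ℚ)) (C := 1) (one_smul _ _) v),
    padicValNat_tamagawaProduct_twist_of_heegner_of_odd W p hp2 K hK hodd hpd hH 1 (one_smul _ _),
    two_mul]

end Tamagawa


end Summit.BirchSwinnertonDyer.Rank1Residual.X2

end
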